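import Summits.Ventures.PercRepro.SevenThreeSmallPlanesFrame
import Summits.Ventures.PercRepro.RLSRuleLineFree

/-!
# PercRepro — the `(7,3)` cell, (R6) part (f1): the line-free planes `U₃,₃`, `U₃,₄`, `U₃,₅` (night-3, gen 4)

For a line-free plane `G` (`NightThree.LineFree`: every triple independent) with `g = |G| ≤ 5` points: `R₃(G)` is
the set of subsets with `≥ 3` points (`R3_eq_of_lineFree`), every `B ∈ R₃(G)` has `λ(B) = 0`
(`lam3_eq_zero_of_lineFree`), so the cell sum is `Σ_{b=3}^{g} C(g, b)·v_t(b, 0)` and the demand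
`Σ_{3 ≤ b ≤ g−t} C(g, b)`; the nine cells `cell_U33_t*`, `cell_U34_t*`, `cell_U35_t*` then give the per-plane
inequality at `t = 1, 2, 3` (`perPlane_lineFree`).  The template for the other six plane types.  Axioms: standard.
-/

namespace PercRepro

namespace SevenThree

open Finset ThmH SixThree PerFlat

variable {α : Type*} [DecidableEq α] {M : Matroid α} [M.Finite]

omit [DecidableEq α] in
/-- A line-free set has no rank-`2` triples. -/
theorem lam3_eq_zero_of_lineFree {G B : Finset α} (h : NightThree.LineFree M G) (hB : B ⊆ G) :
    lam3 M B = 0 := by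
  unfold lam3
  rw [Finset.card_eq_zero, Finset.filter_eq_empty_iff]
  intro T hT h2
  rw [Finset.mem_powersetCard] at hT
  have hind := h T (Finset.mem_powersetCard.2 ⟨hT.1.trans hB, hT.2⟩)
  rw [hind.eRk_eq_encard, Set.encard_coe_eq_coe_finsetCard, hT.2] at h2
  exact absurd h2 (by decide)

/-- `R₃(G)` of a line-free plane with `≤ 5` points: the `3`-, `4`- and `5`-subsets. -/
theorem R3_eq_of_lineFree {G : Finset α} (hG : G ∈ planes M) (h : NightThree.LineFree M G) (hg : G.card ≤ 5) :
    R3 M G = G.powersetCard 3 ∪ G.powersetCard 4 ∪ G.powersetCard 5 := by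
  have hG' : G ∈ flatsQ M 3 := by rw [flatsQ_three]; exact hG
  ext B
  rw [mem_R3_iff, Finset.mem_union, Finset.mem_union, Finset.mem_powersetCard, Finset.mem_powersetCard,
    Finset.mem_powersetCard]
  constructor
  · rintro ⟨hBG, hr⟩
    have h3 := three_le_card_of_eRk_eq_three hr
    have h5 : B.card ≤ 5 := (Finset.card_le_card hBG).trans hg
    rcases (show B.card = 3 ∨ B.card = 4 ∨ B.card = 5 by omega) with hc | hc | hc
    · exact Or.inl (Or.inl ⟨hBG, hc⟩)
    · exact Or.inl (Or.inr ⟨hBG, hc⟩)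
    · exact Or.inr ⟨hBG, hc⟩
  · intro hB
    have hBG : B ⊆ G := by rcases hB with (h | h) | h <;> exact h.1
    have hc : 3 ≤ B.card := by rcases hB with (h | h) | h <;> omega
    exact ⟨hBG, NightThree.eRk_eq_three_of_lineFree_card hG' hBG (NightThree.lineFree_subset h hBG) hc⟩

/-- The cell sum of a line-free plane: `Σ_{B ∈ R₃(G)} f(|B|) = C(g,3) f(3) + C(g,4) f(4) + C(g,5) f(5)`. -/
theorem sum_R3_lineFree {G : Finset α} (hG : G ∈ planes M) (h : NightThree.LineFree M G) (hg : G.card ≤ 5)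
    (f : ℕ → ℚ) :
    ∑ B ∈ R3 M G, f B.card = (G.card.choose 3 : ℚ) * f 3 + (G.card.choose 4 : ℚ) * f 4 + (G.card.choose 5 : ℚ) * f 5 := by
  have hd12 : Disjoint (G.powersetCard 3) (G.powersetCard 4) := disjoint_powersetCard_of_ne G (by decide)
  have hd3 : Disjoint (G.powersetCard 3 ∪ G.powersetCard 4) (G.powersetCard 5) := by
    rw [Finset.disjoint_union_left]
    exact ⟨disjoint_powersetCard_of_ne G (by decide), disjoint_powersetCard_of_ne G (by decide)⟩
  rw [R3_eq_of_lineFree hG h hg, Finset.sum_union hd3, Finset.sum_union hd12]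
  have hc : ∀ k : ℕ, ∑ B ∈ G.powersetCard k, f B.card = (G.card.choose k : ℚ) * f k := by
    intro k
    rw [Finset.sum_congr rfl (fun B hB => by rw [(Finset.mem_powersetCard.1 hB).2]), Finset.sum_const,
      Finset.card_powersetCard, nsmul_eq_mul]
  rw [hc 3, hc 4, hc 5]

/-- The demand count of a line-free plane at type `t`. -/
theorem card_filter_R3_lineFree {G : Finset α} (hG : G ∈ planes M) (h : NightThree.LineFree M G) (hg : G.card ≤ 5)
    (t : ℕ) :
    ((R3 M G).filter (fun B => B.card + t ≤ G.card)).card =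
      (if 3 + t ≤ G.card then G.card.choose 3 else 0) + (if 4 + t ≤ G.card then G.card.choose 4 else 0) +
        (if 5 + t ≤ G.card then G.card.choose 5 else 0) := by
  have hc : ∀ k : ℕ, ((G.powersetCard k).filter (fun B => B.card + t ≤ G.card)).card =
      if k + t ≤ G.card then G.card.choose k else 0 := by
    intro k
    by_cases hk : k + t ≤ G.card
    · rw [if_pos hk, ← Finset.card_powersetCard]
      congr 1
      apply Finset.filter_true_of_mem
      intro B hB
      rw [(Finset.mem_powersetCard.1 hB).2]
      exact hk
    · rw [if_neg hk, Finset.card_eq_zero, Finset.filter_eq_empty_iff]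
      intro B hB
      rw [(Finset.mem_powersetCard.1 hB).2]
      exact hk
  have hd12 : Disjoint ((G.powersetCard 3).filter (fun B => B.card + t ≤ G.card))
      ((G.powersetCard 4).filter (fun B => B.card + t ≤ G.card)) :=
    Finset.disjoint_filter_filter (disjoint_powersetCard_of_ne G (by decide))
  have hd3 : Disjoint ((G.powersetCard 3).filter (fun B => B.card + t ≤ G.card) ∪
      (G.powersetCard 4).filter (fun B => B.card + t ≤ G.card))
      ((G.powersetCard 5).filter (fun B => B.card + t ≤ G.card)) := by
    rw [Finset.disjoint_union_left]
    exact ⟨Finset.disjoint_filter_filter (disjoint_powersetCard_of_ne G (by decide)),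
      Finset.disjoint_filter_filter (disjoint_powersetCard_of_ne G (by decide))⟩
  rw [R3_eq_of_lineFree hG h hg, Finset.filter_union, Finset.filter_union,
    Finset.card_union_of_disjoint hd3, Finset.card_union_of_disjoint hd12, hc 3, hc 4, hc 5]

/-- **The line-free planes at `t = 1, 2, 3`.**  With the naive demand `hdem` and no `4`-point line, a line-free plane
`G` with `3 ≤ |G| ≤ 5` of a simple rank-`7` matroid satisfies the per-plane inequality. -/
theorem perPlane_lineFree (hs : Simple M) (hrank : M.eRank = 7) {G : Finset α} (hG : G ∈ planes M)
    (h : NightThree.LineFree M G) (hg3 : 3 ≤ G.card) (hg : G.card ≤ 5) {t : ℕ} (ht1 : 1 ≤ t) (ht3 : t ≤ 3)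
    (ht : M.eRk ((gr M \ G : Finset α) : Set α) + (t : ℕ∞) = 7)
    (hno4 : ∀ L ∈ lines M, (L ∩ G).card ≤ 3)
    (hdem : (UqG M 7 3 G).card ≤ ((R3 M G).filter (fun B => B.card + t ≤ G.card)).card) :
    (28 / 5 : ℚ) * ((UqG M 7 3 G).card : ℚ) ≤ ∑ S ∈ Yq M 7 3, fRule M G S / D M S := by
  have hlam : ∀ B ∈ R3 M G, lam3 M B = 0 := fun B hB => lam3_eq_zero_of_lineFree h (mem_R3_iff.1 hB).1
  have hcard := card_filter_R3_lineFree hG h hg t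
  rcases (show t = 1 ∨ t = 2 ∨ t = 3 by omega) with rfl | rfl | rfl
  · apply perPlane_t1_of_cell hs hrank hG ht hno4 hdem
    rw [Finset.sum_congr rfl (fun B hB => by rw [hlam B hB]), sum_R3_lineFree hG h hg (fun b => Cells.vOne b 0), hcard]
    rcases (show G.card = 3 ∨ G.card = 4 ∨ G.card = 5 by omega) with hc | hc | hc <;> rw [hc] <;>
      norm_num [Nat.choose] <;> linarith [Cells.cell_U33_t1, Cells.cell_U34_t1, Cells.cell_U35_t1]
  · apply perPlane_t2_of_cell hs hrank hG ht hno4 hdem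
    rw [Finset.sum_congr rfl (fun B hB => by rw [hlam B hB]), sum_R3_lineFree hG h hg (fun b => Cells.vTwo b 0), hcard]
    rcases (show G.card = 3 ∨ G.card = 4 ∨ G.card = 5 by omega) with hc | hc | hc <;> rw [hc] <;>
      norm_num [Nat.choose] <;> linarith [Cells.cell_U33_t2, Cells.cell_U34_t2, Cells.cell_U35_t2]
  · apply perPlane_t3_of_cell hs hrank hG ht hno4 hdem
    rw [Finset.sum_congr rfl (fun B hB => by rw [hlam B hB]), sum_R3_lineFree hG h hg (fun b => Cells.vThree b 0), hcard]
    rcases (show G.card = 3 ∨ G.card = 4 ∨ G.card = 5 by omega) with hc | hc | hc <;> rw [hc] <;>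
      norm_num [Nat.choose] <;> linarith [Cells.cell_U33_t3, Cells.cell_U34_t3, Cells.cell_U35_t3]

end SevenThree

end PercRepro
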